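import Summits.CriticalPhenomena.PercolationContinuityZ3.Theorems.PercNearOneGluingNoHeavyLowerTailSahiTwoChainWRCoefficients
import Summits.CriticalPhenomena.PercolationContinuityZ3.Theorems.PercNearOneGluingNoHeavyLowerTailSahiMixtureMonotoneCells
import Summits.CriticalPhenomena.PercolationContinuityZ3.Theorems.PercNearOneGluingNoHeavyLowerTailSahiMixtureTopRowSquare
import HarnessLib

/-!
# TCP consequence: every coin cell on a chain-moment law (monotone mixture of product measures) is BERNSTEIN-positive, at every order

Support file of the one-cut programme (crux `NoHeavyLowerTail`, stmt-CriticalPhenomena-4575; cell `prim-masterthm`, seat P3, gen 16;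
`run/shared/lean/prim/prim-masterthm/prim-masterthm-p3/HIERARCHY.md` §24; memo
`run/shared/lean/prim/prim-masterthm/FROM-prim-masterthm-p3-g16-TWO-CHAIN-COEFFICIENTS.md` §3(ii)).

Gen 15 proved (`…SahiMixtureMonotoneCells`) that for laws with CHAIN MOMENTS (monotone mixtures of product measures, `…SahiMixtureMonotone`) every
OR-coin cell `h ↦ E_m(μ ⊗ coin(h); (1_{A_{s j} ∪ (H if g j)})_j)` is `≥ 0` on `[0,1]` — by moment transfer to the product of the two chains `Fin L × Bool`
with the product weight `w ⊗ coin(h)` and Lieb–Sahi's two-dimensional theorem — and conjectured (memo of gen 15, §3(d): 636 random cells, `n ≤ 8`) that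
these cells are BERNSTEIN-positive of degree `m`.  With the coefficientwise two-chain theorem of `…SahiTwoChainWRCoefficients` this is now immediate:
* **`bernsteinPos_sahiE_coinWeight_of_monotone`** — on a finite chain `α` with a probability weight `w`, for nonnegative monotone `f_0,…,f_{m−1}` on
  `α × Bool`, `h ↦ E_m^{w ⊗ coin(h)}(f)` is Bernstein-positive of degree `m` (the bridge with `ν' = coin(h)`, whose masses sum to `1` for EVERY real
  `h`, writes it as `Σ_c h^{#c}(1−h)^{m−#c}·(nonnegative)`);
* **`bernsteinPos_orCoin_cell_of_chainMoments`**, instance **`bernsteinPos_orCoin_cell_of_monotoneMixture`** — every cell of the H-MIX ladder on this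
  class is Bernstein-positive, for every `m`, every injective choice of members and every set `G` of OR-ed slots (the cells `2 ≤ |G| ≤ n−2` FAIL on the
  full hereditary class `𝒦_n`, gen 13 `hmixClosure_fails`; `|G| ∈ {0, m}` were gen 15's chain theorems).
HONEST FRAMING: a statement about Sahi's `E_n` for conditionally independent events with co-monotone conditional probabilities; nothing here asserts
(M⁺-k) or `C_k` for `k ≥ 3`.  Everything PROVED, standard axioms; no new definitions. [this work]
-/

noncomputable section

open scoped Classical

namespace Summit.CriticalPhenomena.PercolationContinuityZ3.Theorems

open Finset Function
open Literature.Combinatorics.Sahi2008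
open Literature.Probability.Percolation.DecisionTree (ind ind_of_mem ind_of_not_mem ind_nonneg)
open SahiMixture

namespace SahiTwoChain

section Coin

variable {α : Type*} [Fintype α]

/-- The coin masses sum to one for every real bias. [this work] -/
theorem sum_coin (h : ℝ) : ∑ b : Bool, (bif b then h else 1 - h) = 1 := by
  rw [Fintype.sum_bool]
  simp

/-- A Bernstein monomial read off a Boolean pattern: `h ↦ Π_b (h if c_b else 1−h)` is Bernstein-positive of degree `m`. [this work] -/
theorem bernsteinPos_coinMonomial {m : ℕ} (c : Fin m → Bool) :
    BernsteinPos m (fun h => ∏ b, (bif c b then h else 1 - h)) := by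
  refine BernsteinPos.finProd m (fun b h => bif c b then h else 1 - h) fun b => ?_
  cases c b
  · simpa using bernsteinPos_one_sub
  · simpa using bernsteinPos_id

/-- **Bernstein positivity of `E_m` under `w ⊗ coin(h)` on `α × Bool`, `α` a finite chain**: for a probability weight `w` and nonnegative monotone
`f_0,…,f_{m−1}` on `α × Bool` (product order, `false < true`), `h ↦ E_m^{w⊗coin(h)}(f)` is Bernstein-positive of degree `m`.  (TCP: the bridge
`sahiE_prodWeight_eq_sum_et` with the coin as second factor is a polynomial identity valid for every real `h`; its coefficients `et_coef_nonneg ≥ 0`.)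
[this work] -/
theorem bernsteinPos_sahiE_coinWeight_of_monotone [LinearOrder α] (w : α → ℝ) (hw0 : ∀ x, 0 ≤ w x) (hw1 : ∑ x, w x = 1)
    {m : ℕ} (f : Fin m → α × Bool → ℝ) (hf : ∀ i z, 0 ≤ f i z) (hmono : ∀ i, Monotone (f i)) :
    BernsteinPos m (fun h => sahiE (coinWeight w h) m f) := by
  have key : ∀ h : ℝ, sahiE (coinWeight w h) m f =
      ∑ r : Fin m → α, ∑ c : Fin m → Bool, ((∏ j, w (r j)) * ∏ j, (bif c j then h else 1 - h)) *
        et (univ : Finset (Fin m)) (univ : Finset (Fin m)) m (fun i (p : Fin m × Fin m) => f i (r p.1, c p.2)) :=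
    fun h => sahiE_prodWeight_eq_sum_et w (fun b : Bool => bif b then h else 1 - h) hw1 (sum_coin h) m f
  refine BernsteinPos.congr ?_ fun h _ _ => key h
  refine BernsteinPos.sum _ fun r _ => BernsteinPos.sum _ fun c _ => ?_
  have hcoef : 0 ≤ (∏ j, w (r j)) *
      et (univ : Finset (Fin m)) (univ : Finset (Fin m)) m (fun i (p : Fin m × Fin m) => f i (r p.1, c p.2)) :=
    mul_nonneg (Finset.prod_nonneg fun j _ => hw0 _) (et_coef_nonneg f hf hmono r c)
  exact ((bernsteinPos_coinMonomial c).smul hcoef).congr fun h _ _ => by ring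

end Coin

/-! ### The cells of the mixture ladder on chain-moment laws -/

section Cells

variable {α : Type*} [Fintype α] {L n : ℕ}

/-- **Every OR-coin cell of a chain-moment law is Bernstein-positive, at every order.**  Hypothesis (`chain moments`, as in
`…SahiMixtureChainMoments`): `E[Π_r 1_{A_{e r}}] = Σ_l w_l Π_r y_{l,e r}` for injective `e` (`w` a probability weight on `Fin L`, `0 ≤ y ≤ 1`, `y_{·,i}`
nondecreasing).  Conclusion: for every `m`, every injective `s : Fin m → Fin n` and every `g : Fin m → Bool`,
`h ↦ E_m(μ ⊗ coin(h); (1_{A_{s j} ∪ (H if g j)})_j)` is Bernstein-positive of degree `m`.  Moment transfer to `Fin L × Bool` (gen 15, verbatim, now for every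
real `h`) + `bernsteinPos_sahiE_coinWeight_of_monotone`. [this work] -/
theorem bernsteinPos_orCoin_cell_of_chainMoments (μ : α → ℝ) (A : Fin n → Set α)
    (w : Fin L → ℝ) (hw0 : ∀ l, 0 ≤ w l) (hw1 : ∑ l, w l = 1)
    (y : Fin L → Fin n → ℝ) (hy0 : ∀ l i, 0 ≤ y l i) (hy1 : ∀ l i, y l i ≤ 1) (hmono : ∀ i, Monotone (fun l => y l i))
    (hmom : ∀ (k : ℕ) (e : Fin k → Fin n), Function.Injective e →
      ex μ (∏ r, ind (A (e r))) = ∑ l, w l * ∏ r, y l (e r))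
    {m : ℕ} (s : Fin m → Fin n) (hs : Function.Injective s) (g : Fin m → Bool) :
    BernsteinPos m (fun h => sahiE (coinWeight μ h) m (fun j => ind (orCoin (A (s j)) (g j)))) := by
  -- latent space `Fin L × Bool`, functions `φ j (l, c) = 1` if `g j ∧ c`, else `y l (s j)`
  let φ : Fin m → Fin L × Bool → ℝ := fun j p => bif (g j && p.2) then 1 else y p.1 (s j)
  have hφ0 : ∀ j p, 0 ≤ φ j p := by
    intro j p; simp only [φ]; cases (g j && p.2) <;> simp [hy0]
  have hφm : ∀ j, Monotone (φ j) := by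
    intro j p q hpq
    have hl : p.1 ≤ q.1 := hpq.1
    have hc : p.2 ≤ q.2 := hpq.2
    simp only [φ]
    cases hgj : g j
    · simpa using hmono (s j) hl
    · cases hp : p.2 <;> cases hq : q.2
      · simpa using hmono (s j) hl
      · simpa using hy1 p.1 (s j)
      · rw [hp, hq] at hc; exact absurd hc (by decide)
      · simp
  -- the moment transfer, for every real `h`
  have htransfer : ∀ h : ℝ, sahiE (coinWeight μ h) m (fun j => ind (orCoin (A (s j)) (g j))) = sahiE (coinWeight w h) m φ := by
    intro h
    refine SahiMixture.sahiE_congr_of_moments (coinWeight μ h) (coinWeight w h) (fun j => ind (orCoin (A (s j)) (g j))) φ ?_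
    intro k e he
    rw [show (∏ r, ind (orCoin (A (s (e r))) (g (e r)))) = ∏ r, ind (orCoin ((A ∘ s) (e r)) (g (e r))) from rfl,
      ex_coinWeight_prod_ind_orCoin_cell μ (A ∘ s) g h e,
      show (∏ r, ind ((A ∘ s) (e r))) = ∏ r, ind (A ((s ∘ e) r)) from rfl, hmom k (s ∘ e) (hs.comp he)]
    have hrest : ex μ (fun a => ∏ r, (bif g (e r) then (1 : ℝ) else ind ((A ∘ s) (e r)) a))
        = ∑ l, w l * ∏ r, (bif g (e r) then (1 : ℝ) else y l (s (e r))) := by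
      set S : Finset (Fin k) := Finset.univ.filter fun r => (fun r => g (e r)) r = false with hS
      let e' : Fin S.card → Fin n := fun i => s (e ((S.equivFin.symm i : S) : Fin k))
      have he' : Function.Injective e' := by
        intro i j hij
        have := (hs.comp he) hij
        exact S.equivFin.symm.injective (Subtype.ext this)
      have key := hmom S.card e' he'
      have lhs : (fun a => ∏ r, (bif g (e r) then (1 : ℝ) else ind ((A ∘ s) (e r)) a)) = ∏ i, ind (A (e' i)) := by
        funext a
        rw [Finset.prod_apply, prod_bif_eq_prod_equivFin (fun r => g (e r)) (fun r => ind ((A ∘ s) (e r)) a)]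
        rfl
      rw [lhs, key]
      refine Finset.sum_congr rfl fun l _ => ?_
      rw [prod_bif_eq_prod_equivFin (fun r => g (e r)) (fun r => y l (s (e r)))]
    rw [hrest, ex_def, Fintype.sum_prod_type]
    simp only [φ, Fintype.sum_bool, Finset.prod_apply, Function.comp, Bool.and_true, Bool.and_false, cond_false,
      Finset.mul_sum, ← Finset.sum_add_distrib]
    refine Finset.sum_congr rfl fun l _ => ?_
    rw [show coinWeight w h (l, false) = w l * (1 - h) from rfl, show coinWeight w h (l, true) = w l * h from rfl]
    ring
  exact (bernsteinPos_sahiE_coinWeight_of_monotone w hw0 hw1 φ hφ0 hφm).congr fun h _ _ => htransfer h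

/-- **Instance: every OR-coin cell of a monotone mixture of product measures is Bernstein-positive, at every order** — the conjecture of the gen-15
memo §3(d), including all the cells `2 ≤ |G| ≤ n − 2` that fail on the full hereditary class. [this work] -/
theorem bernsteinPos_orCoin_cell_of_monotoneMixture {ι : Type*} [Fintype ι] [DecidableEq ι]
    (w : Fin L → ℝ) (hw0 : ∀ l, 0 ≤ w l) (hw1 : ∑ l, w l = 1)
    (y : Fin L → ι → ℝ) (hy0 : ∀ l i, 0 ≤ y l i) (hy1 : ∀ l i, y l i ≤ 1) (hmono : ∀ i, Monotone (fun l => y l i))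
    {m : ℕ} (e : Fin m → ι) (he : Function.Injective e) (g : Fin m → Bool) :
    BernsteinPos m (fun h => sahiE (coinWeight (mixProdWeight w y) h) m (fun j => ind (orCoin (bitEv (e j)) (g j)))) :=
  bernsteinPos_orCoin_cell_of_chainMoments (mixProdWeight w y) (fun j => bitEv (e j)) w hw0 hw1 (fun l j => y l (e j))
    (fun l j => hy0 l (e j)) (fun l j => hy1 l (e j)) (fun j => hmono (e j))
    (fun _ e' he' => ex_mixProdWeight_prod_ind w y (e ∘ e') (he.comp he')) id injective_id g

end Cells

end SahiTwoChain

end Summit.CriticalPhenomena.PercolationContinuityZ3.Theorems
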